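import Summits.ResolutionOfSingularities.ResolutionOfSingularities.Theorems.EquisingularLiftEquisingularLiftNatTowerConeRoundOldThree
import Summits.ResolutionOfSingularities.ResolutionOfSingularities.Theorems.EquisingularLiftEquisingularLiftNatTowerCechRoundCloserRootThree
import Summits.ResolutionOfSingularities.ResolutionOfSingularities.Theorems.EquisingularLiftEquisingularLiftNatTowerCechRootCentre
import Summits.ResolutionOfSingularities.ResolutionOfSingularities.Theorems.EquisingularLiftEquisingularLiftNatTowerConeRoundThree
import HarnessLib

/-!
# [OURS · L1 W4.5(b) · EL♮(3)] S6 `hCech` IN THE v7 SHAPE, CLOSED MODULO (L)/(N3)/(N3′-kiv): `Tower.hCech₃_of_lift_sec_kiv`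
# — the FRAMES + (N3′) RE-CUT variant of …NatTowerCechRoundCloserLiftThree (`Tower.hCech₃_of_lift_sec`, p576661)

res-L1-w45b-stub-4 g8, 2026-08-27T22:35Z. OURS; NOT a statement of any manuscript; AI-written, weaker than expert review. No `sorry`; standard axioms.
DEF-FREE. `--supports stmt-ResolutionOfSingularities-20148 --as helper`. CREDIT: the FRAMES edit (and this file's base text, default heartbeats) is
res-D-pv-018 g5's cell draft `…CloserLiftThreeFrames` VERBATIM; the statement/proof underneath are p576661 (stub-4) and through it res-D-pv-057's
…CloserLift chain; the (N3′) gap is res-L1-w45b-stub-2 g8's FINDING 2026-08-27T21:54:54Z (split of record: desk RULING 22:17:09Z).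

WHY (frames, res-D-pv-018). p576661 concludes the v6-shape `hCech` binder and takes a closer-level hypothesis `hFrameAll` (2-frames for EVERY `(G, T, Z)`
and every regular flat centre with that trace) which is REFUTABLE as universally typed, so nobody could ever feed it. The v7/V5 assemblies (p576510 /
p577961) instead hand the S6 closer, INSIDE the `hCech` binder, the frames of the round's own stage `(G, T, Z)`.
WHY (kiv, res-L1-w45b-stub-2). The (N3′) stand-in `hShadowOld` of p576661 receives (k-i), (k-ii-loc), (k-iii), (k-v), (k-vi) of the old `Tower.Shadow₃`
pair but NOT its (k-iv) clause — and its own conclusion (3) at a point of `(E ∩ closure K) ∖ Z`, where `τ` is a local isomorphism, IS the old (k-iv)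
verbatim; the model `𝓔 = (e)`, `𝒦 = (xy − ϖ²)` in `𝔸³_O` (centre `𝓔 ⊔ (x − 1)`) satisfies every other antecedent while `𝒪/(e, xy − ϖ²)` at the origin
is not regular. So `hShadowOld` as cut is not dischargeable by anyone.
EDITS w.r.t. p576661: (1) binder `hFrameAll` deleted; (2) the conclusion gains the per-round frames antecedent (text = v7's binder verbatim), `intro`'d as
`hfr` and used at the one place `hFrameAll T Z hZ` stood; (3) `hShadowOld` gains the `Shadow₃` (k-iv) clause right after (k-iii); (4) both off-shadow /
empty-shadow dispatches go through `Tower.inv₃_cechRound_old_kiv` (…NatTowerCechRoundOldThree, appended), which passes `hk_iv`. `hLift`, `hShadow`,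
`hYsp`, `hTj` unchanged.
PLUG (res-D-pv-018's n = 3 closers `…three_of_cechCtx`): `hS6 := fun k _ _ O _ _ _ _ _ θ hθ P q Y Ch hChStep hChSplit hYsp hYirr hYcl hPint hPnoeth hPreg
hqprop hqsm hTj => Tower.hCech₃_of_lift_sec_kiv O k θ hθ P q hqprop Y hYirr hYcl hPnoeth hPreg Ch hChSplit hChStep (hLift …) (hShadow …) (hShadowOld …)
hYsp hTj` once (L) (res-D-pv-051 / res-L1-w45b-stub-2 p572408), (N3) `hShadow` (res-L1-w45b-stub-2 g8 …NatCechShadowNew) and (N3′) `hShadowOld`-kiv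
(res-L1-w45b-stub-2 g8 …NatCechShadowOld) are theorems.
-/

set_option linter.dupNamespace false -- mandated namespace `Summit.<Summit>.<Problem>` of this single-conjunct summit
set_option linter.overlappingInstances false -- signatures carry `[IsDomain O] [IsDiscreteValuationRing O]`

noncomputable section

open CategoryTheory CategoryTheory.Limits AlgebraicGeometry TopologicalSpace Topology IsLocalRing
open Literature.AlgebraicGeometry.Resolution
open Literature.AlgebraicGeometry.Morphisms (ProjCech.PP ProjCech.toSpec)
open AlgebraicGeometry.Scheme.IdealSheafData
open Summit.ResolutionOfSingularities.ResolutionOfSingularities.Theses.EquisingularLift.Split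
open Summit.ResolutionOfSingularities.ResolutionOfSingularities.Cruxes.EquisingularLift.StrataSplit

namespace Summit.ResolutionOfSingularities.ResolutionOfSingularities.Cruxes.EquisingularLiftNat.Sections

/-- **S6 `hCech` (v7 shape) closed modulo the DIRECTION LIFT (L) and the two shadow stand-ins (N3)/(N3′-kiv)** — `Tower.hCech₃_of_lift_sec`
(p576661) VERBATIM with exactly three edits: the closer-level `hFrameAll` binder is GONE and the conclusion is res-D-pv-018's v7 `hCech` binder, which
carries input (c) for the round's own stage as an antecedent (res-D-pv-018's frames edit); and the (N3′) stand-in `hShadowOld` ALSO receives the old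
pair's (k-iv) clause of `Tower.Shadow₃` right after (k-iii), the Čech dispatches going through `Tower.inv₃_cechRound_old_kiv`. [OURS · L1 W4.5b · pure
logic over the landed rounds] toward `stub_elnat_coneTowerPointResolution` / `stub_elnat_ratNoseTowerResolution` at `n = 3`
(stmt-ResolutionOfSingularities-20148 / -20038); NOT a statement of the manuscript. -/
theorem Tower.hCech₃_of_lift_sec_kiv (O : Type) [CommRing O] [IsDomain O] [IsDiscreteValuationRing O] (k : Type) [Field k]
    (θ : O →+* k) (hθ : Function.Surjective θ)
    (P : Scheme.{0}) (q : P ⟶ Spec (.of O)) (hqprop : IsProper q) (Y : Set P) (hYirr : IsIrreducible Y) (hYcl : IsClosed Y)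
    (hPnoeth : IsLocallyNoetherian P) (hPreg : Scheme.IsRegular P)
    (Ch : ∀ X' : Scheme.{0}, (X' ⟶ P) → Set X' → Prop)
    (hChain : ∀ (X' : Scheme.{0}) (σ : X' ⟶ P) (S : Set X'), Ch X' σ S → Chain P Y X' σ S)
    (hStep : ∀ (X' X'' : Scheme.{0}) (σ' : X' ⟶ P) (S' : Set X') (C : X'.IdealSheafData) (τ : X'' ⟶ X'),
      Ch X' σ' S' → IsBlowup τ C → Scheme.IsRegular C.subscheme → Flat (C.subschemeι ≫ σ' ≫ q) →
      σ' '' (C.support : Set X') ⊆ {x : P | ¬ IsGenericPoint x Y} →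
      (C.support : Set X') ∩ (σ' ≫ q) ⁻¹' {IsLocalRing.closedPoint O} ⊆ S' →
      Ch X'' (τ ≫ σ') (closure (τ ⁻¹' (S' \ (C.support : Set X')))))
    -- (L) the direction lift at the root (T-DIRLIFT-UP's conclusion, frames at every point of `V(I)`)
    (hLift : ∀ {F₉ : Scheme.{0}} (Z₉ : Set F₉) (hZ₉ : IsClosed Z₉)
        (G : Scheme.{0}) (E : Set G) (hE : IsClosed E) (Z : Set G) (hZ : IsClosed Z)
        (X₀ : Scheme.{0}) (σ₀ : X₀ ⟶ P) (I : X₀.IdealSheafData) (G₀ : Scheme.{0}) (j₀ : G₀ ⟶ X₀) (t₀ : G₀ ⟶ Spec (.of k))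
        (Z₀ : Set G₀) (hZ₀ : IsClosed Z₀) (G₁ : Scheme.{0}) (υ₁ : G₁ ⟶ G₀) (ϱ : G ⟶ G₁)
        (E₁ : Set G₁) (hE₁ : IsClosed E₁) (Γ₁ : Set G₁) (hΓ₁ : IsClosed Γ₁)
        (ε : redSub G E hE ⟶ redSub G₁ E₁ hE₁) (εZ : redSub G Z hZ ⟶ redSub G₁ Γ₁ hΓ₁) (𝒟' : G₀.IdealSheafData),
        -- the root (R1)–(R4)
        IsIntegral X₀ → IsLocallyNoetherian X₀ → Scheme.IsRegular X₀ →
        IsPullback j₀ t₀ (σ₀ ≫ q) (Spec.map (CommRingCat.ofHom θ)) →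
        Scheme.IsRegular I.subscheme → Flat (I.subschemeι ≫ σ₀ ≫ q) →
        (∀ x ∈ I.support, ∃ c : Fin 2 → X₀.presheaf.stalk x, Ideal.span (Set.range c) = stalkIdeal I x ∧ IsQuasiRegular c) →
        RationalCarrier (redSub F₉ Z₉ hZ₉) →
        (RationalCarrier (redSub F₉ Z₉ hZ₉) → ∃ e₁ : I.subscheme ≅ ProjCech.PP O 1, e₁.hom ≫ ProjCech.toSpec O 1 = I.subschemeι ≫ σ₀ ≫ q) →
        I.comap j₀ = vanishingIdeal ⟨Z₀, hZ₀⟩ →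
        -- the downstairs round at the root: blow-up of the carrier trace, the pushed section `Γ₁ ⊆ E₁ = υ₁⁻¹Z₀`
        IsBlowup υ₁ (vanishingIdeal (⟨Z₀, hZ₀⟩ : Closeds G₀)) → E₁ = υ₁ ⁻¹' Z₀ → Γ₁ ⊆ E₁ → Γ₁ = ϱ '' Z → Z ⊆ E →
        (∃ δ₁ : redSub G₁ Γ₁ hΓ₁ ⟶ redSub G₀ Z₀ hZ₀, δ₁ ≫ redSubι G₀ Z₀ hZ₀ = redSubι G₁ Γ₁ hΓ₁ ≫ υ₁ ∧ IsIso δ₁) →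
        (∀ (i₁ : redSub G₁ Γ₁ hΓ₁ ⟶ redSub G₁ E₁ hE₁), i₁ ≫ redSubι G₁ E₁ hE₁ = redSubι G₁ Γ₁ hΓ₁ →
          ∀ x₁ : redSub G₁ Γ₁ hΓ₁, IsRegularLocalRing ((redSub G₁ E₁ hE₁).presheaf.stalk (i₁ x₁))) →
        -- the stage's unobstructedness datum, handed with the special-fibre isomorphisms (exceptional pair abstracted)
        IsIso ε → ε ≫ redSubι G₁ E₁ hE₁ = redSubι G E hE ≫ ϱ → IsIso εZ → εZ ≫ redSubι G₁ Γ₁ hΓ₁ = redSubι G Z hZ ≫ ϱ →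
        (∀ x : redSub G Z hZ, IsRegularLocalRing (G.presheaf.stalk (redSubι G Z hZ x))) → DirStepUnobs G E hE Z hZ →
        -- the downstairs direction of `Γ₁` (DIRDICT (a) `exists_direction_of_section`, output block verbatim)
        vanishingIdeal (⟨Z₀, hZ₀⟩ : Closeds G₀) * vanishingIdeal (⟨Z₀, hZ₀⟩ : Closeds G₀) ≤ 𝒟' → 𝒟' ≤ vanishingIdeal (⟨Z₀, hZ₀⟩ : Closeds G₀) →
        (∀ z ∈ Z₀, ∃ c : Fin 2 → G₀.presheaf.stalk z,
          Ideal.span (Set.range c) = stalkIdeal (vanishingIdeal (⟨Z₀, hZ₀⟩ : Closeds G₀)) z ∧ IsQuasiRegular c ∧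
          stalkIdeal 𝒟' z = Ideal.span {c 0} ⊔ Ideal.span {c 1 * c 1}) →
        controlledTransform υ₁ (vanishingIdeal (⟨Z₀, hZ₀⟩ : Closeds G₀)) 𝒟' 1 = vanishingIdeal (⟨Γ₁, hΓ₁⟩ : Closeds G₁) →
        ∃ 𝒟 : X₀.IdealSheafData, I * I ≤ 𝒟 ∧ 𝒟 ≤ I ∧
          (∀ x ∈ I.support, ∃ c : Fin 2 → X₀.presheaf.stalk x, Ideal.span (Set.range c) = stalkIdeal I x ∧ IsQuasiRegular c ∧
            stalkIdeal 𝒟 x = Ideal.span {c 0} ⊔ Ideal.span {c 1 * c 1}) ∧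
          𝒟.comap j₀ = 𝒟')
    -- (N3) the transported shadow next to the NEW surface, off the shadow
    (hShadow : ∀ {F₉ : Scheme.{0}} (Z₉ : Set F₉) (hZ₉ : IsClosed Z₉) {F₁₀ : Scheme.{0}} (υ' : F₁₀ ⟶ F₉)
        (G G' : Scheme.{0}) (γ : G ⟶ F₁₀) (T E K : Set G) (hE : IsClosed E) (Z : Set G) (hZ : IsClosed Z) (υ₂ : G' ⟶ G),
        DirStepSec F₉ F₁₀ υ' Z₉ hZ₉ G γ Z hZ → IsBlowup υ₂ (vanishingIdeal ⟨Z, hZ⟩) →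
        ∀ (X : Scheme.{0}) (σ : X ⟶ P) (S : Set X) (jG : G ⟶ X) (tG : G ⟶ Spec (.of k)) (𝓔 𝒦 𝒦₁ : X.IdealSheafData)
        (X₂ : Scheme.{0}) (τ : X₂ ⟶ X) (j₂ : G' ⟶ X₂) (t₂ : G' ⟶ Spec (.of k)),
        Ch X σ S → IsIntegral X → IsLocallyNoetherian X → Scheme.IsRegular X → IsDominant (σ ≫ q) →
        IsPullback jG tG (σ ≫ q) (Spec.map (CommRingCat.ofHom θ)) → jG '' T = S →
        𝓔.comap jG = vanishingIdeal ⟨E, hE⟩ → (∀ z : X, (stalkIdeal 𝓔 z).IsPrincipal) → Scheme.IsRegular 𝓔.subscheme →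
        (∀ z : X, (stalkIdeal 𝒦 z).IsPrincipal) → ∀ (V : G.Opens), E ⊆ (V : Set G) →
        (𝒦.comap jG).comap V.ι = (vanishingIdeal (⟨closure K, isClosed_closure⟩ : Closeds G)).comap V.ι →
        Flat ((𝓔 ⊔ 𝒦).subschemeι ≫ σ ≫ q) → IsEffectiveCartier (𝓔.comap 𝒦.subschemeι) → IsEffectiveCartier (𝒦.comap 𝓔.subschemeι) →
        (𝓔 ⊔ 𝒦₁).comap jG = vanishingIdeal ⟨Z, hZ⟩ → Flat ((𝓔 ⊔ 𝒦₁).subschemeι ≫ σ ≫ q) → Scheme.IsRegular (𝓔 ⊔ 𝒦₁).subscheme →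
        IsEffectiveCartier (𝒦₁.comap 𝓔.subschemeι) →
        IsBlowup τ (𝓔 ⊔ 𝒦₁) → IsPullback j₂ t₂ ((τ ≫ σ) ≫ q) (Spec.map (CommRingCat.ofHom θ)) → j₂ ≫ τ = υ₂ ≫ jG →
        IsClosed K → K ⊆ closure (K \ E) → K ≠ Set.univ → closure (Z \ closure K) = Z →
        ((strictTransformIdeal τ (𝓔 ⊔ 𝒦₁) 𝒦).comap j₂).comap (υ₂ ⁻¹ᵁ V).ι =
            (vanishingIdeal (⟨closure (closure (υ₂ ⁻¹' (K \ Z))), isClosed_closure⟩ : Closeds G')).comap (υ₂ ⁻¹ᵁ V).ι ∧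
          Flat ((((𝓔 ⊔ 𝒦₁).comap τ) ⊔ strictTransformIdeal τ (𝓔 ⊔ 𝒦₁) 𝒦).subschemeι ≫ (τ ≫ σ) ≫ q) ∧
          (∀ (hE' : IsClosed (υ₂ ⁻¹' Z)) (y : G'),
            j₂ y ∈ ((((𝓔 ⊔ 𝒦₁).comap τ) ⊔ strictTransformIdeal τ (𝓔 ⊔ 𝒦₁) 𝒦).support : Set X₂) →
            stalkIdeal (vanishingIdeal (⟨υ₂ ⁻¹' Z, hE'⟩ : Closeds G') ⊔
              vanishingIdeal (⟨closure (closure (υ₂ ⁻¹' (K \ Z))), isClosed_closure⟩ : Closeds G')) y =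
            stalkIdeal (vanishingIdeal (⟨υ₂ ⁻¹' Z ∩ closure (closure (υ₂ ⁻¹' (K \ Z))), hE'.inter isClosed_closure⟩ : Closeds G')) y →
            IsRegularLocalRing (X₂.presheaf.stalk (j₂ y) ⧸
              stalkIdeal (((𝓔 ⊔ 𝒦₁).comap τ) ⊔ strictTransformIdeal τ (𝓔 ⊔ 𝒦₁) 𝒦) (j₂ y))) ∧
          IsEffectiveCartier (((𝓔 ⊔ 𝒦₁).comap τ).comap (strictTransformIdeal τ (𝓔 ⊔ 𝒦₁) 𝒦).subschemeι) ∧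
          IsEffectiveCartier ((strictTransformIdeal τ (𝓔 ⊔ 𝒦₁) 𝒦).comap ((𝓔 ⊔ 𝒦₁).comap τ).subschemeι))
    -- (N3′) the transported shadow next to the OLD surface, off the shadow — RE-CUT: PLUS the old pair's (k-iv) clause after (k-iii)
    (hShadowOld : ∀ {F₉ : Scheme.{0}} (Z₉ : Set F₉) (hZ₉ : IsClosed Z₉) {F₁₀ : Scheme.{0}} (υ' : F₁₀ ⟶ F₉)
        (G G' : Scheme.{0}) (γ : G ⟶ F₁₀) (T E K : Set G) (hE : IsClosed E) (Z : Set G) (hZ : IsClosed Z) (υ₂ : G' ⟶ G),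
        DirStepSec F₉ F₁₀ υ' Z₉ hZ₉ G γ Z hZ → IsBlowup υ₂ (vanishingIdeal ⟨Z, hZ⟩) →
        ∀ (X : Scheme.{0}) (σ : X ⟶ P) (S : Set X) (jG : G ⟶ X) (tG : G ⟶ Spec (.of k)) (𝓔 𝒦 𝒦₁ : X.IdealSheafData)
        (X₂ : Scheme.{0}) (τ : X₂ ⟶ X) (j₂ : G' ⟶ X₂) (t₂ : G' ⟶ Spec (.of k)),
        Ch X σ S → IsIntegral X → IsLocallyNoetherian X → Scheme.IsRegular X → IsDominant (σ ≫ q) →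
        IsPullback jG tG (σ ≫ q) (Spec.map (CommRingCat.ofHom θ)) → jG '' T = S →
        𝓔.comap jG = vanishingIdeal ⟨E, hE⟩ → (∀ z : X, (stalkIdeal 𝓔 z).IsPrincipal) → Scheme.IsRegular 𝓔.subscheme →
        (∀ z : X, (stalkIdeal 𝒦 z).IsPrincipal) → ∀ (V : G.Opens), E ⊆ (V : Set G) →
        (𝒦.comap jG).comap V.ι = (vanishingIdeal (⟨closure K, isClosed_closure⟩ : Closeds G)).comap V.ι →
        Flat ((𝓔 ⊔ 𝒦).subschemeι ≫ σ ≫ q) →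
        (∀ y : G, jG y ∈ ((𝓔 ⊔ 𝒦).support : Set X) →
          stalkIdeal (vanishingIdeal (⟨E, hE⟩ : Closeds G) ⊔ vanishingIdeal (⟨closure K, isClosed_closure⟩ : Closeds G)) y =
            stalkIdeal (vanishingIdeal (⟨E ∩ closure K, hE.inter isClosed_closure⟩ : Closeds G)) y →
          IsRegularLocalRing (X.presheaf.stalk (jG y) ⧸ stalkIdeal (𝓔 ⊔ 𝒦) (jG y))) →
        IsEffectiveCartier (𝓔.comap 𝒦.subschemeι) → IsEffectiveCartier (𝒦.comap 𝓔.subschemeι) →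
        (𝓔 ⊔ 𝒦₁).comap jG = vanishingIdeal ⟨Z, hZ⟩ → Flat ((𝓔 ⊔ 𝒦₁).subschemeι ≫ σ ≫ q) → Scheme.IsRegular (𝓔 ⊔ 𝒦₁).subscheme →
        IsEffectiveCartier (𝒦₁.comap 𝓔.subschemeι) →
        IsBlowup τ (𝓔 ⊔ 𝒦₁) → IsPullback j₂ t₂ ((τ ≫ σ) ≫ q) (Spec.map (CommRingCat.ofHom θ)) → j₂ ≫ τ = υ₂ ≫ jG →
        IsClosed K → K ⊆ closure (K \ E) → K ≠ Set.univ → closure (Z \ closure K) = Z →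
        ((strictTransformIdeal τ (𝓔 ⊔ 𝒦₁) 𝒦).comap j₂).comap (υ₂ ⁻¹ᵁ V).ι =
            (vanishingIdeal (⟨closure (closure (υ₂ ⁻¹' (K \ Z))), isClosed_closure⟩ : Closeds G')).comap (υ₂ ⁻¹ᵁ V).ι ∧
          Flat ((strictTransformIdeal τ (𝓔 ⊔ 𝒦₁) 𝓔 ⊔ strictTransformIdeal τ (𝓔 ⊔ 𝒦₁) 𝒦).subschemeι ≫ (τ ≫ σ) ≫ q) ∧
          (∀ (hE' : IsClosed (closure (υ₂ ⁻¹' (E \ Z)))) (y : G'),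
            j₂ y ∈ ((strictTransformIdeal τ (𝓔 ⊔ 𝒦₁) 𝓔 ⊔ strictTransformIdeal τ (𝓔 ⊔ 𝒦₁) 𝒦).support : Set X₂) →
            stalkIdeal (vanishingIdeal (⟨closure (υ₂ ⁻¹' (E \ Z)), hE'⟩ : Closeds G') ⊔
              vanishingIdeal (⟨closure (closure (υ₂ ⁻¹' (K \ Z))), isClosed_closure⟩ : Closeds G')) y =
            stalkIdeal (vanishingIdeal (⟨closure (υ₂ ⁻¹' (E \ Z)) ∩ closure (closure (υ₂ ⁻¹' (K \ Z))), hE'.inter isClosed_closure⟩ :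
              Closeds G')) y →
            IsRegularLocalRing (X₂.presheaf.stalk (j₂ y) ⧸
              stalkIdeal (strictTransformIdeal τ (𝓔 ⊔ 𝒦₁) 𝓔 ⊔ strictTransformIdeal τ (𝓔 ⊔ 𝒦₁) 𝒦) (j₂ y))) ∧
          IsEffectiveCartier ((strictTransformIdeal τ (𝓔 ⊔ 𝒦₁) 𝓔).comap (strictTransformIdeal τ (𝓔 ⊔ 𝒦₁) 𝒦).subschemeι) ∧
          IsEffectiveCartier ((strictTransformIdeal τ (𝓔 ⊔ 𝒦₁) 𝒦).comap (strictTransformIdeal τ (𝓔 ⊔ 𝒦₁) 𝓔).subschemeι))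
    -- the cone-witnessed sub-case goes through res-L1-w45b-stub-4's `Tower.inv₃_coneRound_new_sec` (frames from the round's antecedent, rationality from `hTj`)
    (hYsp : Y ⊆ q ⁻¹' {IsLocalRing.closedPoint O})
    (hTj : RationalCarrierLift O k θ P q) :
    -- ======== the `hCech` binder of res-D-pv-018's `hsub_reachTower_four_of_kcl` (v7, p576510) / `hsub_reachNoseTowerV5_four_of` (p577961), VERBATIM ========
    ∀ {F₉ : Scheme.{0}} (Z₉ : Set F₉) (hZ₉ : IsClosed Z₉) {F₁₀ : Scheme.{0}} (υ' : F₁₀ ⟶ F₉)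
        (G G' : Scheme.{0}) (γ : G ⟶ F₁₀) (T E K : Set G) (hE : IsClosed E) (Z : Set G) (hZ : IsClosed Z) (υ₂ : G' ⟶ G) (K' : Set G'),
        (Tower.Inv₃ O k θ P q Y Ch (DirLift.Ruled O k θ P q Y) F₉ Z₉ hZ₉ F₁₀ υ' G γ T E K ∧ IsClosed K ∧ K ⊆ closure (K \ E) ∧ K ≠ Set.univ) →
        Z ⊆ E ∩ T → Z.Nonempty → TowerFull F₉ F₁₀ υ' Z₉ hZ₉ G γ Z hZ →
        (DirStepSec F₉ F₁₀ υ' Z₉ hZ₉ G γ Z hZ ∧ RationalCarrier (redSub F₉ Z₉ hZ₉) ∧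
          (∀ x : redSub G Z hZ, IsRegularLocalRing (G.presheaf.stalk (redSubι G Z hZ x))) ∧
          (∀ (i : redSub G Z hZ ⟶ redSub G E hE), i ≫ redSubι G E hE = redSubι G Z hZ →
            ∀ x : redSub G Z hZ, IsRegularLocalRing ((redSub G E hE).presheaf.stalk (i x))) ∧ DirStepUnobs G E hE Z hZ) →
        -- input (c) AT THIS ROUND (res-D-pv-018 v7): quasi-regular 2-frames of every regular `O`-flat centre with trace `𝓘⟨Z⟩` on a `Ch`-stage of `(G, T)` —
        -- handed in by the assembly (derived there from the carrier datum through the section iso); replaces the closer-level `hFrameAll`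
        (∀ (X : Scheme.{0}) (σ : X ⟶ P) (S : Set X) (jG : G ⟶ X) (tG : G ⟶ Spec (.of k)) (𝒞 : X.IdealSheafData),
          Ch X σ S → IsIntegral X → IsLocallyNoetherian X → Scheme.IsRegular X → IsDominant (σ ≫ q) →
          IsPullback jG tG (σ ≫ q) (Spec.map (CommRingCat.ofHom θ)) → jG '' T = S →
          𝒞.comap jG = vanishingIdeal ⟨Z, hZ⟩ → Flat (𝒞.subschemeι ≫ σ ≫ q) → Scheme.IsRegular 𝒞.subscheme →
          ∀ x ∈ 𝒞.support, ∃ c : Fin 2 → X.presheaf.stalk x, Ideal.span (Set.range c) = stalkIdeal 𝒞 x ∧ IsQuasiRegular c) →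
        IsBlowup υ₂ (vanishingIdeal (⟨Z, hZ⟩ : Closeds G)) →
        (K' = ∅ ∨ ((ConeWitness G E hE K Z hZ ∨ closure (Z \ closure K) = Z) ∧ K' = closure (υ₂ ⁻¹' (K \ Z)))) →
        (Tower.Inv₃ O k θ P q Y Ch (DirLift.Ruled O k θ P q Y) F₉ Z₉ hZ₉ F₁₀ υ' G' (υ₂ ≫ γ) (closure (υ₂ ⁻¹' (T \ Z))) (υ₂ ⁻¹' Z) K' ∧
            IsClosed K' ∧ K' ⊆ closure (K' \ υ₂ ⁻¹' Z) ∧ K' ≠ Set.univ) ∧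
          (Tower.Inv₃ O k θ P q Y Ch (DirLift.Ruled O k θ P q Y) F₉ Z₉ hZ₉ F₁₀ υ' G' (υ₂ ≫ γ) (closure (υ₂ ⁻¹' (T \ Z))) (closure (υ₂ ⁻¹' (E \ Z))) K' ∧
            IsClosed K' ∧ K' ⊆ closure (K' \ closure (υ₂ ⁻¹' (E \ Z))) ∧ K' ≠ Set.univ) := by
  intro F₉ Z₉ hZ₉ F₁₀ υ' G G' γ T E K hE Z hZ υ₂ K' hI hZET hZne hfull hwit hfr hυ₂ hK'
  haveI := hqprop
  obtain ⟨hinv, hKcl, hKE, hKne⟩ := hI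
  obtain ⟨hsec, hrat, hGreg, hEreg, hunobs⟩ := hwit
  have hGint : IsIntegral G := hinv.2.2.1
  have hEcl : IsClosed E := hinv.2.2.2.2.2.1
  have hTE : ¬ T ⊆ E := hinv.2.2.2.2.2.2.1
  haveI := hGint
  have hZE : Z ⊆ E := fun z hz => (hZET hz).1
  have hTZ : ¬ T ⊆ Z := fun h => hTE (h.trans hZE)
  have hZsupp : ((vanishingIdeal (⟨Z, hZ⟩ : Closeds G) : G.IdealSheafData).support : Set G) = Z :=
    Scheme.IdealSheafData.coe_support_vanishingIdeal _
  -- the two `Tower.Inv₂` conclusions, for the three admitted shapes of `K′`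
  have hboth : Tower.Inv₃ O k θ P q Y Ch (DirLift.Ruled O k θ P q Y) F₉ Z₉ hZ₉ F₁₀ υ' G' (υ₂ ≫ γ) (closure (υ₂ ⁻¹' (T \ Z))) (υ₂ ⁻¹' Z) K' ∧
      Tower.Inv₃ O k θ P q Y Ch (DirLift.Ruled O k θ P q Y) F₉ Z₉ hZ₉ F₁₀ υ' G' (υ₂ ≫ γ) (closure (υ₂ ⁻¹' (T \ Z)))
        (closure (υ₂ ⁻¹' (E \ Z))) K' := by
    -- the Čech centre at this stage, (N1) fed with the witness
    have hC := Tower.hCentre_of_root O k θ hθ P q Y Ch (Tower.hRootCentre_of_lift O k θ hθ P q Y hLift) Z₉ hZ₉ υ' G γ T E hE Z hZ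
      hZET hZne hfull hTE hsec hrat hGreg hEreg hunobs
    have hS := hShadow Z₉ hZ₉ υ' G G' γ T E K hE Z hZ υ₂ hsec hυ₂
    have hSo := hShadowOld Z₉ hZ₉ υ' G G' γ T E K hE Z hZ υ₂ hsec hυ₂
    rcases hK' with hK0 | ⟨hcase, hKst⟩
    · exact ⟨Tower.inv₃_cechRound_new O k θ hθ P q Y hYirr hYcl hPnoeth hPreg Ch hChain hStep Z₉ hZ₉ υ' G G' γ T E K hE Z hZ υ₂ hinv hZET hfull
          hsec hυ₂ hKcl hKE hKne hC hS K' (Or.inl hK0),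
        Tower.inv₃_cechRound_old_kiv O k θ hθ P q Y hYirr hYcl hPnoeth hPreg Ch hChain hStep Z₉ hZ₉ υ' G G' γ T E K hE Z hZ υ₂ hinv hZET hfull
          hυ₂ hKcl hKE hKne hC hSo K' (Or.inl hK0)⟩
    · rcases hcase with hcone | hoff
      · -- cone-witnessed as well: res-D-pv-029's cone-round bricks (stand-ins discharged by stub-2's S4/S5, S2 passed through)
        have hK'' : K' = ∅ ∨ K' = closure (υ₂ ⁻¹' (K \ Z)) := Or.inr hKst
        exact ⟨Tower.inv₃_coneRound_new_sec O k θ hθ P q Y hYsp hYirr hYcl hPnoeth hPreg Ch hChain hStep Z₉ hZ₉ υ' G G' γ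
            T E K hE Z hZ υ₂ hinv hZET hZne hsec hcone hυ₂ hKcl hKE hKne hfr hTj K' hK'',
          Tower.inv₃_coneRound_old O k θ hθ P q Y hYirr hYcl hPnoeth hPreg Ch hChain hStep (DirLift.Ruled O k θ P q Y) Z₉ hZ₉ υ' G G' γ
            T E K hE Z hZ υ₂ hinv hZET hZne hfull hcone hυ₂ hKcl hKE
            (Tower.subset_closure_diff_of_inv₃_coneWitness O k θ hθ P q Y Ch (DirLift.Ruled O k θ P q Y) Z₉ hZ₉ υ' G γ T E K hE Z hZ hinv hfull hZE hcone)
            (fun X σ jG 𝓔 𝒦 X'' τ j₂ t₂ _ _ hcomm _ he h => by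
              obtain ⟨e, he⟩ := he
              exact DirLift.ruled_comp h τ υ₂ j₂ hcomm _ e he _) K' hK''⟩
      · exact ⟨Tower.inv₃_cechRound_new O k θ hθ P q Y hYirr hYcl hPnoeth hPreg Ch hChain hStep Z₉ hZ₉ υ' G G' γ T E K hE Z hZ υ₂ hinv hZET hfull
            hsec hυ₂ hKcl hKE hKne hC hS K' (Or.inr ⟨hoff, hKst⟩),
          Tower.inv₃_cechRound_old_kiv O k θ hθ P q Y hYirr hYcl hPnoeth hPreg Ch hChain hStep Z₉ hZ₉ υ' G G' γ T E K hE Z hZ υ₂ hinv hZET hfull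
            hυ₂ hKcl hKE hKne hC hSo K' (Or.inr ⟨hoff, hKst⟩)⟩
  obtain ⟨hnew, hold⟩ := hboth
  have hG'int : IsIntegral G' := hnew.2.2.1
  haveI := hG'int
  -- the downstairs side facts of `K′` (res-D-pv-029's …NatTowerSideFacts)
  rcases hK' with rfl | ⟨-, rfl⟩
  · exact ⟨⟨hnew, isClosed_empty, Set.empty_subset _, Set.empty_ne_univ⟩, ⟨hold, isClosed_empty, Set.empty_subset _, Set.empty_ne_univ⟩⟩
  · have hne : closure (υ₂ ⁻¹' (K \ Z)) ≠ Set.univ :=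
      closure_preimage_ne_univ υ₂ _ hυ₂ K Z hKcl hKne hZ (fun h => hTZ (h ▸ Set.subset_univ _)) hZsupp.le _
        (Set.preimage_mono fun z hz => hz.1)
    refine ⟨⟨hnew, isClosed_closure, closure_preimage_diff_subset_closure_diff_preimage υ₂ K Z, hne⟩,
      ⟨hold, isClosed_closure, ?_, hne⟩⟩
    have h := closure_preimage_diff_subset_of_isBlowup υ₂ (vanishingIdeal (⟨Z, hZ⟩ : Closeds G)) hυ₂ K E hEcl hKE
    rw [hZsupp] at h
    exact h



end Summit.ResolutionOfSingularities.ResolutionOfSingularities.Cruxes.EquisingularLiftNat.Sections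

end
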